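import Summits.ResolutionOfSingularities.ResolutionOfSingularities.Theorems.PurelyInseparableDim4JointHereditarySurvival
import HarnessLib

/-!
# Purely inseparable four-folds: SURVIVAL of ONE READING of an atlas member under the blow-up of a disjoint centre (brick S3 (c) v4,
# tranche 1, brick A2-chart; cell `res-dim4-pi`)

[OURS · counted 0] (D-0157 DOOR 2; host item stmt-ResolutionOfSingularities-16155, helper). Nothing here proves resolution of
singularities in dimension ≥ 4 / characteristic `p`. v3-H part 63's `member_survival_zigzag_shape_regions` WITHOUT the single-chart
hypothesis `c ⊆ range φ` (an atlas member is covered by several readings, `res-dim4-typ-3/S3c-V4-ATLAS-MEMBERS-DESIGN.md` §1–2, A2), its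
proof verbatim otherwise: `π : W → X′` the blow-up along `Ce`, `c` closed and disjoint from `V(Ce)`, a zigzag `X′ ←φ— Y —ψ→ 𝔸⁵` reading an
ideal `I` as `J` and `𝓘(c)` as `𝓘Λ(S)` and seeing `V(z, x_S)`, with a translated-hyperplane dictionary for a list `E` ⇒ the SURVIVOR zigzag
`W ←φ′— Y′ —ψ′→ 𝔸⁵` reads the controlled transform as `J` and `𝓘(π⁻¹c)` as `𝓘Λ(S)`, sees `V(z, x_S)`, carries every set `D ⊆ ψ(Y)` whose image
`φ(ψ⁻¹ D)` misses `V(Ce)` to `φ′(ψ′⁻¹ D) = π⁻¹ φ(ψ⁻¹ D)` (the owned parts and fibre pieces of the reading), and the dictionary propagates to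
the strict transforms and the new exceptional component (which misses the survivor).

* **`reading_survival_zigzag_shape`**. AI-produced formalisation, weaker than expert review.
bears_on: LADDER-RESOLUTION:D157-DOOR2 (res-dim4-pi · S3 (c) v4 A2-chart).
-/

set_option linter.dupNamespace false -- D-0017: single-problem summit path `Summit.<S>.<S>.…` by design

noncomputable section

open MvPolynomial Finset CategoryTheory AlgebraicGeometry Opposite TopologicalSpace
open AlgebraicGeometry.Scheme.IdealSheafData (ofIdealTop vanishingIdeal)

namespace Summit.ResolutionOfSingularities.ResolutionOfSingularities.Theorems.PIDim4

open Literature.AlgebraicGeometry.Resolution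
open Literature.AlgebraicGeometry.Resolution.AffinePointBlowup (P A γ coord Wtop ξ)

namespace Equimultiple

section ReadingSurvival

variable {K : Type} [Field K]
variable {X' W Y : Scheme.{0}} {π : W ⟶ X'} {Ce : X'.IdealSheafData} {S : Finset (Fin 4)}

/-- **SURVIVAL OF A READING OF AN ATLAS MEMBER.** See the module docstring. [cite: BierstoneGrigorievMilmanWlodarczyk2011, Def. 3.1.3 (2), (4)]
[cite: StacksProject, Tag 02OS] -/
theorem reading_survival_zigzag_shape [IsLocallyNoetherian X'] [IsLocallyNoetherian W] (hπ : IsBlowup π Ce)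
    (c : Closeds X') (hdisj : Disjoint (c : Set X') (Ce.support : Set X')) (φ : Y ⟶ X') [IsOpenImmersion φ]
    (ψ : Y ⟶ P 4 K) [IsOpenImmersion ψ] (I : X'.IdealSheafData) (J : (P 4 K).IdealSheafData)
    (hI : I.comap φ = J.comap ψ) (μ : ℕ)
    (hZ : (vanishingIdeal c).comap φ = (AffineCoordBlowup.𝓘Λ 4 K (insert 0 (Fin.succ '' (S : Set (Fin 4))))).comap ψ)
    (hsee : (AffineCoordBlowup.CΛ 4 K (insert 0 (Fin.succ '' (S : Set (Fin 4)))) : Set (P 4 K)) ⊆ Set.range ψ)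
    (E : List X'.IdealSheafData) (idx : X'.IdealSheafData → Fin 4) (cst : X'.IdealSheafData → K)
    (hshape : ∀ D ∈ E,
      ((D.support : Set X') ∩ φ '' (ψ ⁻¹'
        (AffineCoordBlowup.CΛ 4 K (insert 0 (Fin.succ '' (S : Set (Fin 4)))) : Set (P 4 K)))).Nonempty →
      D.comap φ = (ofIdealTop (Ideal.span {(γ 4 K).symm (X (idx D).succ + C (cst D))})).comap ψ ∧
        (idx D ∈ S → cst D = 0))
    (hinj : ∀ D₁ ∈ E, ∀ D₂ ∈ E,
      ((D₁.support : Set X') ∩ φ '' (ψ ⁻¹'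
        (AffineCoordBlowup.CΛ 4 K (insert 0 (Fin.succ '' (S : Set (Fin 4)))) : Set (P 4 K)))).Nonempty →
      ((D₂.support : Set X') ∩ φ '' (ψ ⁻¹'
        (AffineCoordBlowup.CΛ 4 K (insert 0 (Fin.succ '' (S : Set (Fin 4)))) : Set (P 4 K)))).Nonempty →
      idx D₁ = idx D₂ → D₁ = D₂) :
    ∃ (Y' : Scheme.{0}) (φ' : Y' ⟶ W) (ψ' : Y' ⟶ P 4 K) (_ : IsOpenImmersion φ') (_ : IsOpenImmersion ψ'),
      (controlledTransform π Ce I μ).comap φ' = J.comap ψ' ∧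
      (vanishingIdeal (c.preimage π.continuous)).comap φ' =
        (AffineCoordBlowup.𝓘Λ 4 K (insert 0 (Fin.succ '' (S : Set (Fin 4))))).comap ψ' ∧
      (AffineCoordBlowup.CΛ 4 K (insert 0 (Fin.succ '' (S : Set (Fin 4)))) : Set (P 4 K)) ⊆ Set.range ψ' ∧
      (∀ D : Set (P 4 K), D ⊆ Set.range ψ → Disjoint (φ '' (ψ ⁻¹' D)) (Ce.support : Set X') →
        D ⊆ Set.range ψ' ∧ φ' '' (ψ' ⁻¹' D) = π ⁻¹' (φ '' (ψ ⁻¹' D))) ∧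
      ∃ (idx₂ : W.IdealSheafData → Fin 4) (cst₂ : W.IdealSheafData → K),
        (∀ D₂ ∈ E.map (strictTransformIdeal π Ce) ++ [Ce.comap π],
          ((D₂.support : Set W) ∩ φ' '' (ψ' ⁻¹'
            (AffineCoordBlowup.CΛ 4 K (insert 0 (Fin.succ '' (S : Set (Fin 4)))) : Set (P 4 K)))).Nonempty →
          D₂.comap φ' = (ofIdealTop (Ideal.span {(γ 4 K).symm (X (idx₂ D₂).succ + C (cst₂ D₂))})).comap ψ' ∧
            (idx₂ D₂ ∈ S → cst₂ D₂ = 0)) ∧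
        (∀ D₁ ∈ E.map (strictTransformIdeal π Ce) ++ [Ce.comap π], ∀ D₂ ∈ E.map (strictTransformIdeal π Ce) ++ [Ce.comap π],
          ((D₁.support : Set W) ∩ φ' '' (ψ' ⁻¹'
            (AffineCoordBlowup.CΛ 4 K (insert 0 (Fin.succ '' (S : Set (Fin 4)))) : Set (P 4 K)))).Nonempty →
          ((D₂.support : Set W) ∩ φ' '' (ψ' ⁻¹'
            (AffineCoordBlowup.CΛ 4 K (insert 0 (Fin.succ '' (S : Set (Fin 4)))) : Set (P 4 K)))).Nonempty →
          idx₂ D₁ = idx₂ D₂ → D₁ = D₂) := by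
  classical
  set O : X'.Opens := ⟨(Ce.support : Set X')ᶜ, Ce.support.isClosed.isOpen_compl⟩ with hO_def
  have hO : Disjoint (O : Set X') Ce.support := disjoint_compl_left
  haveI : IsIso (π ∣_ O) := hπ.isIso_morphismRestrict hO
  have hcO : ∀ x : X', x ∈ (c : Set X') → x ∈ O := fun x hx h => hdisj.le_bot ⟨hx, h⟩
  have hmem := mem_member_iff_mem_CΛ φ ψ c hZ
  -- the transported chart
  set φ' : (φ ⁻¹ᵁ O : Scheme.{0}) ⟶ W := (φ ∣_ O) ≫ inv (π ∣_ O) ≫ (π ⁻¹ᵁ O).ι with hφ'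
  set ψ' : (φ ⁻¹ᵁ O : Scheme.{0}) ⟶ P 4 K := (φ ⁻¹ᵁ O).ι ≫ ψ with hψ'
  have hfac : φ' ≫ π = (φ ⁻¹ᵁ O).ι ≫ φ := comp_eq_of_zigzag_survival φ
  have hφ'π : ∀ y, π (φ' y) = φ ((φ ⁻¹ᵁ O).ι y) := fun y => by
    rw [← Scheme.Hom.comp_apply, hfac, Scheme.Hom.comp_apply]
  -- the survivor's centre set on the new chart lies over the old one
  have himg' : φ' '' (ψ' ⁻¹' (AffineCoordBlowup.CΛ 4 K (insert 0 (Fin.succ '' (S : Set (Fin 4)))) : Set (P 4 K))) ⊆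
      π ⁻¹' (φ '' (ψ ⁻¹' (AffineCoordBlowup.CΛ 4 K (insert 0 (Fin.succ '' (S : Set (Fin 4)))) : Set (P 4 K)))) := by
    rintro _ ⟨y, hy, rfl⟩
    rw [Set.mem_preimage, hφ'π]
    exact ⟨_, hy, rfl⟩
  -- members of the new boundary meeting the survivor come from members meeting `c`
  have hmeet : ∀ D₂ ∈ E.map (strictTransformIdeal π Ce) ++ [Ce.comap π],
      ((D₂.support : Set W) ∩ φ' '' (ψ' ⁻¹'
        (AffineCoordBlowup.CΛ 4 K (insert 0 (Fin.succ '' (S : Set (Fin 4)))) : Set (P 4 K)))).Nonempty →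
      ∃ D ∈ E, strictTransformIdeal π Ce D = D₂ ∧
        ((D.support : Set X') ∩ φ '' (ψ ⁻¹'
          (AffineCoordBlowup.CΛ 4 K (insert 0 (Fin.succ '' (S : Set (Fin 4)))) : Set (P 4 K)))).Nonempty := by
    intro D₂ hD₂ hne
    obtain ⟨w, hwD, hwc⟩ := hne
    have hπw := himg' hwc
    rw [Set.mem_preimage] at hπw
    rcases List.mem_append.mp hD₂ with hD₂ | hD₂
    · obtain ⟨D, hD, rfl⟩ := List.mem_map.mp hD₂
      refine ⟨D, hD, rfl, π w, ?_, hπw⟩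
      have hle : D.comap π ≤ strictTransformIdeal π Ce D :=
        (comap_le_controlledTransform π Ce D 0).trans (controlledTransform_le_strictTransformIdeal π Ce D 0)
      have hw' := Scheme.IdealSheafData.support_antitone hle hwD
      rw [Scheme.IdealSheafData.support_comap] at hw'
      exact hw'
    · -- the exceptional divisor does not meet the survivor
      exfalso
      rw [List.mem_singleton] at hD₂
      subst hD₂
      rw [Scheme.IdealSheafData.support_comap] at hwD
      have hπwc : π w ∈ (c : Set X') := by
        obtain ⟨y, hy, hyw⟩ := hπw
        rw [← hyw]
        exact (hmem y).mpr hy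
      exact hdisj.le_bot ⟨hπwc, hwD⟩
  -- the new shape data: read through a chosen old member
  let pick : W.IdealSheafData → X'.IdealSheafData := fun D₂ =>
    if h : ∃ D ∈ E, strictTransformIdeal π Ce D = D₂ ∧
        ((D.support : Set X') ∩ φ '' (ψ ⁻¹'
          (AffineCoordBlowup.CΛ 4 K (insert 0 (Fin.succ '' (S : Set (Fin 4)))) : Set (P 4 K)))).Nonempty
    then h.choose else ⊤
  have hpick : ∀ D₂ ∈ E.map (strictTransformIdeal π Ce) ++ [Ce.comap π],
      ((D₂.support : Set W) ∩ φ' '' (ψ' ⁻¹'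
        (AffineCoordBlowup.CΛ 4 K (insert 0 (Fin.succ '' (S : Set (Fin 4)))) : Set (P 4 K)))).Nonempty →
      pick D₂ ∈ E ∧ strictTransformIdeal π Ce (pick D₂) = D₂ ∧
        (((pick D₂).support : Set X') ∩ φ '' (ψ ⁻¹'
          (AffineCoordBlowup.CΛ 4 K (insert 0 (Fin.succ '' (S : Set (Fin 4)))) : Set (P 4 K)))).Nonempty := by
    intro D₂ hD₂ hne
    have h := hmeet D₂ hD₂ hne
    have hp : pick D₂ = h.choose := dif_pos h
    rw [hp]
    exact h.choose_spec
  -- a seen set whose image misses the centre keeps its image (pulled back)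
  have hvis : ∀ D : Set (P 4 K), D ⊆ Set.range ψ → Disjoint (φ '' (ψ ⁻¹' D)) (Ce.support : Set X') →
      D ⊆ Set.range ψ' ∧ φ' '' (ψ' ⁻¹' D) = π ⁻¹' (φ '' (ψ ⁻¹' D)) := by
    intro D hDsee hDdisj
    have hDO : ∀ y : Y, ψ y ∈ D → φ y ∈ O := fun y hy h => hDdisj.le_bot ⟨⟨y, hy, rfl⟩, h⟩
    have himgD : φ' '' (ψ' ⁻¹' D) = π ⁻¹' (φ '' (ψ ⁻¹' D)) := by
      ext w
      constructor
      · rintro ⟨y, hy, rfl⟩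
        rw [Set.mem_preimage, hφ'π]
        exact ⟨_, hy, rfl⟩
      · rintro ⟨y, hy, hyw⟩
        have hyO : y ∈ φ ⁻¹ᵁ O := hDO y hy
        refine ⟨⟨y, hyO⟩, hy, ?_⟩
        refine eq_of_eq_of_not_mem_support hπ ?_ ?_
        · rw [hφ'π]; exact hyw
        · rw [hφ'π]; exact fun h => hO.le_bot ⟨hyO, h⟩
    refine ⟨fun x hx => ?_, himgD⟩
    obtain ⟨y, rfl⟩ := hDsee hx
    exact ⟨⟨y, hDO y hx⟩, rfl⟩
  refine ⟨(φ ⁻¹ᵁ O : Y.Opens), φ', ψ', inferInstance, inferInstance, ?_, ?_, ?_, hvis,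
    fun D₂ => idx (pick D₂), fun D₂ => cst (pick D₂), fun D₂ hD₂ hne => ?_, fun D₁ hD₁ D₂ hD₂ hne₁ hne₂ hidx => ?_⟩
  · rw [hφ', Scheme.IdealSheafData.comap_comp, Scheme.IdealSheafData.comap_comp, comap_controlledTransform_ι_of_disjoint Ce I hO,
      ← Scheme.IdealSheafData.comap_comp _ (inv (π ∣_ O)), IsIso.inv_hom_id, Scheme.IdealSheafData.comap_id,
      ← Scheme.IdealSheafData.comap_comp, morphismRestrict_ι, Scheme.IdealSheafData.comap_comp, hI,
      ← Scheme.IdealSheafData.comap_comp]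
  · rw [← hπ.comap_vanishingIdeal_of_disjoint c hdisj, ← Scheme.IdealSheafData.comap_comp, hfac,
      Scheme.IdealSheafData.comap_comp, hZ, ← Scheme.IdealSheafData.comap_comp]
  · intro v hv
    obtain ⟨y, hy⟩ := hsee hv
    have hyc : φ y ∈ (c : Set X') := (hmem y).mpr (by rw [hy]; exact hv)
    exact ⟨⟨y, hcO _ hyc⟩, by rw [hψ', Scheme.Hom.comp_apply]; exact hy⟩
  · -- the reading of a meeting member
    obtain ⟨hD, hst, hne'⟩ := hpick D₂ hD₂ hne
    obtain ⟨hread, hzero⟩ := hshape _ hD hne'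
    refine ⟨?_, hzero⟩
    show D₂.comap φ' = (ofIdealTop (Ideal.span {(γ 4 K).symm (X (idx (pick D₂)).succ + C (cst (pick D₂)))})).comap ψ'
    conv_lhs => rw [← hst, hφ', comap_strictTransformIdeal_zigzag_survival hO φ, hread]
    rw [hψ', ← Scheme.IdealSheafData.comap_comp]
  · -- injectivity of the index on meeting members
    obtain ⟨hD₁', hst₁, hne₁'⟩ := hpick D₁ hD₁ hne₁
    obtain ⟨hD₂', hst₂, hne₂'⟩ := hpick D₂ hD₂ hne₂
    have h := hinj _ hD₁' _ hD₂' hne₁' hne₂' hidx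
    rw [← hst₁, ← hst₂, h]

end ReadingSurvival

end Equimultiple

end Summit.ResolutionOfSingularities.ResolutionOfSingularities.Theorems.PIDim4

end
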